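import Mathlib
import HarnessLib
import Literature.Computability.AlgebraicComplexity.KabanetsImpagliazzoHardness
import Literature.Computability.AlgebraicComplexity.SparseCircuitBounds
import Literature.Computability.AlgebraicComplexity.ArithCircuitComposition
import Literature.Computability.AlgebraicComplexity.CircuitDepthProductDepthOne
import Literature.Computability.MetaComplexity.NWGenerator
import Summits.ValiantsHypothesis.ValiantsHypothesis.Theorems.DefinabilityGapKIHybridWs
import Summits.ValiantsHypothesis.ValiantsHypothesis.Theorems.DepthWindowConstDepth

/-!
# DefinabilityGap — KI Lemma 30 part I (the hybrid argument) in (product-depth, wires) currency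
# (support for `KIPlantedHitting`, item `stmt-ValiantsHypothesis-23547`; decomp-valiant lens 5, generation 12)

Support for route `route-ValiantsHypothesis-DefinabilityGap`.  The constant-depth rung of the residual
`K1 = KIPlantedHitting` (`DefinabilityGapK1ConstDepthRung.lean`: the KI-planted permanent map hits every polynomial-wire
annihilator of constant product-depth, from the 2025 constant-depth factor-closure theorem [BhattacharjeeEtAl2025] and
lens 4's `DepthWindow.perHardConstDepth`) needs the Kabanets–Impagliazzo hybrid argument with the size accounting done
in the Limaye–Srinivasan–Tavenas measures of the constant-depth literature — unbounded fan-in circuits `ArithCircuit`,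
product-depth `ArithCircuit.productDepth`, wires `ArithCircuit.edgeSize` — instead of `L` (tree:
`exists_root_of_kiGenerator_annihilated`) or `L_ws` (`DefinabilityGapKIHybridWs`).  This file is that kernel:

* `edgeSize_sumOfMonomials_le` — wires of the `ΣΠ` circuit `ArithCircuit.sumOfMonomials` (`≤ #monomials · (deg + 1)`);
* `exists_circuit_aeval_restrict` — a copy of `f` restricted to `≤ r` live variables has a circuit of product-depth
  `≤ 1` with `≤ (deg f + 1)^r (deg f + 1)` wires (sparsity `card_support_le_pow`, transport along a projection by
  lens 4's `DepthWindow.exists_circuit_of_isProjection`);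
* `exists_cd_root_of_kiGenerator_annihilated` — for every NW design with pairwise intersections `≤ r`: a nonzero
  annihilator `D` of `KI-gen_e(f)` computed by a circuit `Γ` yields a nonzero `H(x, c)` with `H(x, f(x)) = 0`,
  `deg H ≤ deg D · max 1 (deg f)`, computed in product-depth `≤ pdepth Γ + 1` with
  `≤ wires Γ + #ι · (deg f + 1)^r (deg f + 1)` wires (composition calculus `ArithCircuit.compose`,
  `Computes.compose`, `edgeSize_compose`, `productDepth_compose_le`).

Parts (a) nonvanishing, (b) root, (c) degree are the same substitution as `DefinabilityGapKIHybridWs`; only the size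
accounting (d)–(f) is new.  Honest framing: circuit bookkeeping for a rung of `K1`; `VP ≠ VNP` untouched.

References: [KabanetsImpagliazzo2003] Lemma 30 (proof, I–II); [BhattacharjeeEtAl2025] Thm. 37 (proof sketch: "exactly
the Kabanets–Impagliazzo generator, with the constant-depth closure theorem in place of Kaltofen");
[LimayeSrinivasanTavenas2025] §2 (wires, product-depth); [Burgisser2000] §2 (projections, composition).
-/

set_option linter.dupNamespace false

noncomputable section

open MvPolynomial
open Literature.Computability.AlgebraicComplexity Literature.Computability.MetaComplexity
open Summit.ValiantsHypothesis.ValiantsHypothesis.Theorems.DepthWindow (exists_circuit_of_isProjection)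

namespace Summit.ValiantsHypothesis.ValiantsHypothesis.Theorems.DefinabilityGapKIHybridCD

/-! ## Sparse polynomials and restricted copies as `ΣΠ` circuits (wires and product-depth) -/

section Sparse

/-- Wires of the `ΣΠ` circuit of `f` along `ms`: if every monomial of `ms` has degree `≤ d` then
`wires ≤ #ms · (d + 1)` (each product gate has fan-in the degree of its monomial, the sum gate has fan-in `#ms`).
[cite: LimayeSrinivasanTavenas2025, §2 (size = wires)] -/
theorem edgeSize_sumOfMonomials_le {σ : Type*} [DecidableEq σ] (ms : List (σ →₀ ℕ)) (f : MvPolynomial σ ℂ)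
    {d : ℕ} (hd : ∀ m ∈ ms, (Finsupp.toMultiset m).card ≤ d) :
    (ArithCircuit.sumOfMonomials ms f).edgeSize ≤ ms.length * (d + 1) := by
  change (((DepthReduction.layerM ms ++ [DepthReduction.pieceGate ms f]) : List (ArithCircuit.Gate ℂ σ)).map
    ArithCircuit.Gate.fanIn).sum ≤ _
  rw [List.map_append, List.sum_append, List.map_singleton, List.sum_singleton]
  have h1 : ((DepthReduction.layerM ms : List (ArithCircuit.Gate ℂ σ)).map ArithCircuit.Gate.fanIn).sum ≤
      ms.length * d := by
    unfold DepthReduction.layerM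
    rw [List.map_map]
    calc (ms.map (ArithCircuit.Gate.fanIn ∘ DepthReduction.monomialGate)).sum
        ≤ (ms.map fun _ => d).sum := List.sum_le_sum fun m hm => by
            simpa [ArithCircuit.Gate.fanIn, ArithCircuit.Gate.args, DepthReduction.monomialGate] using hd m hm
      _ = ms.length * d := by rw [List.map_const', List.sum_replicate, smul_eq_mul]
  have h2 : ArithCircuit.Gate.fanIn (DepthReduction.pieceGate ms f : ArithCircuit.Gate ℂ σ) = ms.length := by
    simp [ArithCircuit.Gate.fanIn, ArithCircuit.Gate.args, DepthReduction.pieceGate]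
  rw [h2]
  nlinarith

/-- **Restriction lemma in (product-depth, wires) currency**: substituting constants for the variables of `f` outside a
set `T` of `≤ r` positions and variables `x_{π b}` for `b ∈ T` yields a polynomial computed by a circuit of
product-depth `≤ 1` with `≤ (deg f + 1)^r · (deg f + 1)` wires (the `ΣΠ` circuit of the `≤ (deg f + 1)^r` monomials in
the `r` live variables, transported along the renaming). [cite: KabanetsImpagliazzo2003, Lemma 30 (proof, II)] -/
theorem exists_circuit_aeval_restrict {β τ : Type*} [DecidableEq β] (f : MvPolynomial β ℂ)
    (g : β → MvPolynomial τ ℂ) (T : Finset β) (π : β → τ) (c : β → ℂ)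
    (hT : ∀ b ∈ T, g b = X (π b)) (hT' : ∀ b ∉ T, g b = C (c b)) {r : ℕ} (hr : T.card ≤ r) :
    ∃ P : ArithCircuit ℂ τ, P.Computes (aeval g f) ∧ P.productDepth ≤ 1 ∧
      P.edgeSize ≤ (f.totalDegree + 1) ^ r * (f.totalDegree + 1) := by
  classical
  set h : β → MvPolynomial T ℂ := fun b => if hb : b ∈ T then X ⟨b, hb⟩ else C (c b) with hh
  set q : MvPolynomial T ℂ := aeval h f with hq
  have hfac : aeval g f = rename (fun t : T => π t) q := by
    rw [hq, ← AlgHom.comp_apply, comp_aeval]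
    refine congrArg (fun g' => aeval g' f) (funext fun b => ?_)
    by_cases hb : b ∈ T
    · rw [hT b hb, hh]
      simp only [hb, dif_pos, rename_X]
    · rw [hT' b hb, hh]
      simp only [hb, dif_neg, not_false_eq_true, rename_C]
  have hdeg : q.totalDegree ≤ f.totalDegree := by
    have h1 : ∀ b, (h b).totalDegree ≤ 1 := by
      intro b
      by_cases hb : b ∈ T
      · rw [hh]; simp only [hb, dif_pos]; exact (isHomogeneous_X ℂ _).totalDegree_le
      · rw [hh]; simp only [hb, dif_neg, not_false_eq_true, totalDegree_C]; exact Nat.zero_le _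
    exact (Literature.RingTheory.Nullstellensatz.totalDegree_aeval_le h h1 f).trans (by rw [mul_one])
  -- the `ΣΠ` circuit of `q`
  have hP₀c : (ArithCircuit.sumOfMonomials q.support.toList q).Computes q :=
    ArithCircuit.computes_sumOfMonomials (Finset.nodup_toList _) (fun _ hm => Finset.mem_toList.mpr hm)
  have hP₀d : (ArithCircuit.sumOfMonomials q.support.toList q).productDepth ≤ 1 :=
    ArithCircuit.productDepth_sumOfMonomials_le _ _
  have hP₀e : (ArithCircuit.sumOfMonomials q.support.toList q).edgeSize ≤
      (f.totalDegree + 1) ^ r * (f.totalDegree + 1) := by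
    have h1 := edgeSize_sumOfMonomials_le q.support.toList q (d := q.totalDegree) (fun m hm => by
      rw [Finsupp.card_toMultiset]
      exact le_totalDegree (Finset.mem_toList.mp hm))
    rw [Finset.length_toList] at h1
    have hcardT : Fintype.card T ≤ r := by rwa [Fintype.card_coe]
    calc (ArithCircuit.sumOfMonomials q.support.toList q).edgeSize
        ≤ q.support.card * (q.totalDegree + 1) := h1
      _ ≤ (q.totalDegree + 1) ^ Fintype.card T * (q.totalDegree + 1) :=
          Nat.mul_le_mul_right _ (card_support_le_pow q)
      _ ≤ (f.totalDegree + 1) ^ Fintype.card T * (f.totalDegree + 1) := by gcongr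
      _ ≤ (f.totalDegree + 1) ^ r * (f.totalDegree + 1) :=
          Nat.mul_le_mul_right _ (Nat.pow_le_pow_right (Nat.succ_pos _) hcardT)
  -- transport along the renaming, a projection
  have hproj : IsProjection (rename (fun t : T => π t) q) q :=
    ⟨fun t => X (π t), fun t => Or.inl ⟨π t, rfl⟩, by rw [rename_eq_aeval]; rfl⟩
  obtain ⟨P, hPc, hPd, hPe, -⟩ :=
    exists_circuit_of_isProjection hproj (ArithCircuit.sumOfMonomials q.support.toList q) hP₀c
  exact ⟨P, by rwa [hfac], hPd.trans hP₀d, hPe.trans hP₀e⟩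

end Sparse

/-! ## KI Lemma 30, part I (the hybrid argument) in (product-depth, wires) currency -/

section Hybrid

variable {ι α β : Type*} [Fintype ι] [DecidableEq ι] [Fintype β] [DecidableEq β] [DecidableEq α]

/-- `eval x (bind₁ h φ) = eval (eval x ∘ h) φ`. [folklore] -/
private theorem eval_bind₁'' {σ τ : Type*} (x : τ → ℂ) (h : σ → MvPolynomial τ ℂ)
    (φ : MvPolynomial σ ℂ) : eval x (bind₁ h φ) = eval (fun i => eval x (h i)) φ :=
  eval₂Hom_bind₁ _ _ _ _

/-- **KI Lemma 30, part I (hybrid argument) in (product-depth, wires) currency — PROVED.** Let the blocks of `e`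
pairwise meet in at most `r` points. If a nonzero `D` computed by the circuit `Γ` annihilates `KI-gen_e(f)` then `f`
is a ROOT of a nonzero `H ∈ ℂ[x_b, c]` (variables `Option β`, `c = none`): `H(x, f(x)) = 0`,
`deg H ≤ deg D · max 1 (deg f)`, and `H` is computed by a circuit of product-depth `≤ pdepth Γ + 1` with
`≤ wires Γ + #ι · ((deg f + 1)^r · (deg f + 1))` wires (`H = D(g_1, …, g_N)`, every `g_j` a restricted copy of `f` on
`≤ r` live variables, the variable `c`, or a constant; composition of circuits).
[cite: KabanetsImpagliazzo2003, Lemma 30 (proof, I)]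
[cite: BhattacharjeeEtAl2025, Thm. 37 (proof sketch)] -/
theorem exists_cd_root_of_kiGenerator_annihilated {r : ℕ} {e : ι → (β ↪ α)} (he : IsNWDesign r e)
    (f : MvPolynomial β ℂ) {D : MvPolynomial ι ℂ} (hD : D ≠ 0)
    (hann : bind₁ (kiGenerator f e) D = 0) (Γ : ArithCircuit ℂ ι) (hC : Γ.Computes D) :
    ∃ H : MvPolynomial (Option β) ℂ, H ≠ 0 ∧ bind₁ (fun o => o.elim f X) H = 0 ∧
      H.totalDegree ≤ D.totalDegree * max 1 f.totalDegree ∧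
      ∃ P : ArithCircuit ℂ (Option β), P.Computes H ∧ P.productDepth ≤ Γ.productDepth + 1 ∧
        P.edgeSize ≤ Γ.edgeSize + Fintype.card ι * ((f.totalDegree + 1) ^ r * (f.totalDegree + 1)) := by
  classical
  obtain ⟨S, i, hiS, hS, hSi⟩ := exists_critical_kiHybrid f e hD hann
  -- a point where the critical kiHybrid does not vanish
  obtain ⟨v, hv⟩ : ∃ v : α ⊕ ι → ℂ, eval v (kiHybrid f e S D) ≠ 0 := by
    by_contra hcon
    push Not at hcon
    exact hS (MvPolynomial.funext fun v => by rw [hcon v, map_zero])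
  -- the specialisation keeping the block of `i` and the coordinate `c_i` free
  set ψ : α ⊕ ι → MvPolynomial (Option β) ℂ := Sum.elim
    (fun x => if h : ∃ b, e i b = x then X (some h.choose) else C (v (Sum.inl x)))
    (fun j => if j = i then X none else C (v (Sum.inr j))) with hψ
  have hψe : ∀ b, ψ (Sum.inl (e i b)) = X (some b) := by
    intro b
    have h : ∃ b', e i b' = e i b := ⟨b, rfl⟩
    have hc : h.choose = b := (e i).injective h.choose_spec
    simp only [hψ, Sum.elim_inl, dif_pos h, hc]
  have hψi : ψ (Sum.inr i) = X none := by simp only [hψ, Sum.elim_inr, if_true]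
  -- the restricted copies, for `j ≠ i`, as small `ΣΠ` circuits
  have hrestr : ∀ j, j ≠ i → ∃ Q : ArithCircuit ℂ (Option β),
      Q.Computes (bind₁ ψ (rename Sum.inl (rename (e j) f))) ∧ Q.productDepth ≤ 1 ∧
      Q.edgeSize ≤ (f.totalDegree + 1) ^ r * (f.totalDegree + 1) := by
    intro j hji
    rw [bind₁_rename, bind₁_rename, ← aeval_eq_bind₁]
    refine exists_circuit_aeval_restrict f _
      (Finset.univ.filter fun b => ∃ b', e i b' = e j b)
      (fun b => if h : ∃ b', e i b' = e j b then some h.choose else none)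
      (fun b => v (Sum.inl (e j b))) ?_ ?_ ?_
    · intro b hb
      have h : ∃ b', e i b' = e j b := (Finset.mem_filter.1 hb).2
      simp only [Function.comp_apply, hψ, Sum.elim_inl, dif_pos h]
    · intro b hb
      have h : ¬ ∃ b', e i b' = e j b := fun h => hb (Finset.mem_filter.2 ⟨Finset.mem_univ _, h⟩)
      simp only [Function.comp_apply, hψ, Sum.elim_inl, dif_neg h]
    · -- design: the live positions inject into `S_j ∩ S_i`
      refine le_trans ?_ (he hji)
      rw [← Finset.card_map (e j)]
      refine Finset.card_le_card fun x hx => ?_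
      rw [Finset.mem_map] at hx
      obtain ⟨b, hb, rfl⟩ := hx
      obtain ⟨b', hb'⟩ := (Finset.mem_filter.1 hb).2
      rw [Finset.mem_inter, Finset.mem_map, Finset.mem_map]
      exact ⟨⟨b, Finset.mem_univ _, rfl⟩, ⟨b', Finset.mem_univ _, hb'⟩⟩
  -- circuits for all substituted inputs
  have hG : ∀ j, ∃ Q : ArithCircuit ℂ (Option β), Q.Computes (bind₁ ψ (kiHybridSubst f e S j)) ∧
      Q.productDepth ≤ 1 ∧ Q.edgeSize ≤ (f.totalDegree + 1) ^ r * (f.totalDegree + 1) := by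
    intro j
    by_cases hjS : j ∈ S
    · have hji : j ≠ i := fun h => hiS (h ▸ hjS)
      simp only [kiHybridSubst, if_pos hjS, kiGenerator_apply]
      exact hrestr j hji
    · simp only [kiHybridSubst, if_neg hjS, bind₁_X_right]
      by_cases hji : j = i
      · rw [hji, hψi]
        exact ⟨ArithCircuit.ofVar none, rfl, le_of_eq_of_le rfl (Nat.zero_le 1), Nat.zero_le _⟩
      · simp only [hψ, Sum.elim_inr, if_neg hji]
        exact ⟨ArithCircuit.ofConst _, rfl, le_of_eq_of_le rfl (Nat.zero_le 1), Nat.zero_le _⟩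
  choose Q hQc hQd hQe using hG
  refine ⟨bind₁ ψ (kiHybrid f e S D), ?_, ?_, ?_, Γ.compose Q, ?_, ?_, ?_⟩
  · -- (a) nonzero: evaluate at the matching point
    set w : Option β → ℂ := fun o => o.elim (v (Sum.inr i)) fun b => v (Sum.inl (e i b)) with hw
    have hwψ : ∀ u, eval w (ψ u) = v u := by
      rintro (x | j)
      · by_cases h : ∃ b, e i b = x
        · simp only [hψ, Sum.elim_inl, dif_pos h, eval_X, hw, Option.elim_some]
          rw [h.choose_spec]
        · simp only [hψ, Sum.elim_inl, dif_neg h, eval_C]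
      · by_cases hj : j = i
        · subst hj; simp only [hψi, eval_X, hw, Option.elim_none]
        · simp only [hψ, Sum.elim_inr, if_neg hj, eval_C]
    intro h0
    apply hv
    have h1 := congrArg (eval w) h0
    rw [map_zero, eval_bind₁'', show (fun u => eval w (ψ u)) = v from funext hwψ] at h1
    exact h1
  · -- (b) root: substituting `c ↦ f(x)` factors through the (vanishing) next kiHybrid
    set ρ : Option β → MvPolynomial β ℂ := fun o => o.elim f X with hρ
    have key : ∀ u, bind₁ (fun u => bind₁ ρ (ψ u)) (kiStepSubst f e i u) = bind₁ ρ (ψ u) := by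
      rintro (x | j)
      · simp only [kiStepSubst, Sum.elim_inl, bind₁_X_right]
      · by_cases hj : j = i
        · subst hj
          simp only [kiStepSubst, Sum.elim_inr, if_true, kiGenerator_apply]
          rw [bind₁_rename, bind₁_rename, hψi, bind₁_X_right]
          have hcomp : ((fun u => bind₁ ρ (ψ u)) ∘ Sum.inl) ∘ (e j) = X := by
            funext b
            simp only [Function.comp_apply, hψe b, bind₁_X_right, hρ, Option.elim_some]
          rw [hcomp]
          exact (AlgHom.congr_fun bind₁_X_left f).trans (AlgHom.id_apply f)
        · simp only [kiStepSubst, Sum.elim_inr, if_neg hj, bind₁_X_right]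
    have h2 : bind₁ (fun u => bind₁ ρ (ψ u)) (kiHybrid f e (insert i S) D) =
        bind₁ ρ (bind₁ ψ (kiHybrid f e S D)) := by
      rw [kiHybrid_insert, bind₁_bind₁, bind₁_bind₁]
      exact congrArg (fun θ => bind₁ θ (kiHybrid f e S D)) (funext key)
    rw [← h2, hSi, map_zero]
  · -- (c) degree
    rw [kiHybrid, bind₁_bind₁, ← aeval_eq_bind₁]
    refine Literature.RingTheory.Nullstellensatz.totalDegree_aeval_le _ (fun j => ?_) D
    by_cases hjS : j ∈ S
    · simp only [kiHybridSubst, if_pos hjS, kiGenerator_apply]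
      rw [bind₁_rename, bind₁_rename, ← aeval_eq_bind₁]
      refine (Literature.RingTheory.Nullstellensatz.totalDegree_aeval_le _ (δ := 1)
        (fun b => ?_) f).trans (by simp)
      simp only [Function.comp_apply, hψ, Sum.elim_inl]
      split_ifs
      · exact (isHomogeneous_X ℂ _).totalDegree_le
      · rw [totalDegree_C]; exact Nat.zero_le _
    · simp only [kiHybridSubst, if_neg hjS, bind₁_X_right]
      by_cases hji : j = i
      · rw [hji, hψi]
        exact (isHomogeneous_X ℂ _).totalDegree_le.trans (le_max_left _ _)
      · simp only [hψ, Sum.elim_inr, if_neg hji, totalDegree_C]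
        exact Nat.zero_le _
  · -- (d) the composed circuit computes `H = D(g)`
    rw [kiHybrid, bind₁_bind₁, ← aeval_eq_bind₁]
    exact hC.compose hQc
  · -- (e) product-depth
    exact ArithCircuit.productDepth_compose_le hQd Γ
  · -- (f) wires
    rw [ArithCircuit.edgeSize_compose]
    refine Nat.add_le_add_left ?_ _
    calc ∑ j, (Q j).edgeSize ≤ ∑ _j : ι, (f.totalDegree + 1) ^ r * (f.totalDegree + 1) :=
          Finset.sum_le_sum fun j _ => hQe j
      _ = Fintype.card ι * ((f.totalDegree + 1) ^ r * (f.totalDegree + 1)) := by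
          rw [Finset.sum_const, smul_eq_mul, Finset.card_univ]

end Hybrid

end Summit.ValiantsHypothesis.ValiantsHypothesis.Theorems.DefinabilityGapKIHybridCD

end
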